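import Summits.AtomisticToContinuum.Crystallization.Theorems.ThreeConeCertificateSlackRigidityPricedFloorsGlobalize5

/-!
# Globalisation of exact local layerings, VI: one layer forces the next

Helper file for the stub `stub_globalize` of the line `priced-floors-palm-exactification`
(crux `ThreeConeCertificate.SlackRigidity`, item 11960): the exact local-to-global layer lemma
(Hales, *Dense Sphere Packings* §1.3, layer induction) for the admissible layered family of
item 13958.  This file: Hales's "one hexagonal layer forces the next" for the distorted patterns — from a full layer with constant first shell, the full next layer with constant first shell, whose continuing hole triple has an admissible type and height.
-/

noncomputable section

open Set
open Literature.MathematicalPhysics.StatisticalMechanics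
open Summit.AtomisticToContinuum.Crystallization.Theorems.SlackRigidityPricedFloors

namespace Summit.AtomisticToContinuum.Crystallization.Theorems.SlackRigidityPricedFloorsGlobalize

variable {a : ℝ}

/-! ## One layer forces the next -/

section Step

variable {S : Set E3}

/-- Hexagon vectors of an isometric frame are nonzero and short. [folklore] -/
theorem norm_map_lat_hex_bounds (A : E3 ≃ₗᵢ[ℝ] E3) (ha : 47 / 50 ≤ a ∧ a ≤ 1) {c : ℤ × ℤ}
    (hc : c ∈ hexCodes) : 0 < ‖A (lat a c)‖ ∧ ‖A (lat a c)‖ ≤ 28 / 25 := by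
  rw [norm_map_lat_hex A (by linarith [ha.1]) hc]
  exact ⟨by linarith [ha.1], by linarith [ha.2]⟩

/-- Hole-triple vectors of an isometric frame are nonzero and short. [folklore] -/
theorem norm_map_coded_up_bounds (A : E3 ≃ₗᵢ[ℝ] E3) (ha : 47 / 50 ≤ a ∧ a ≤ 1) {σ : ℤ}
    (hσ : σ = 1 ∨ σ = -1) {t : ℝ} (ht : 39 / 50 * a ≤ |t| ∧ |t| ≤ 17 / 20 * a) {c : ℤ × ℤ}
    (hc : c ∈ upCodes σ) : 0 < ‖A (lat a c + t • e3)‖ ∧ ‖A (lat a c + t • e3)‖ ≤ 28 / 25 := by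
  rw [A.norm_map]
  have h2 : ‖lat a c + t • e3‖ ^ 2 = a ^ 2 / 3 + t ^ 2 := by
    rw [norm_coded_sq, Qf_of_mem_upCodes hσ hc]; push_cast; ring
  have hsq := sq_abs t
  have h0 : 0 ≤ ‖lat a c + t • e3‖ := norm_nonneg _
  constructor
  · nlinarith [ha.1, abs_nonneg t]
  · nlinarith [ha.1, ha.2, ht.2, abs_nonneg t]

/-- **A new-layer site with a centrally symmetric shell**: if the shell of `q` contains the
hexagon of the frame `A` and the hole triple of type `−σ` at height `−t` (the layer below), and
is centrally symmetric, it is exactly hexagon ∪ triple ∪ reflected triple. [folklore] -/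
theorem newsite_cs (hS : ∀ y ∈ S, ExactLayeredAt S y) {A : E3 ≃ₗᵢ[ℝ] E3} (ha : 47 / 50 ≤ a ∧ a ≤ 1)
    {σ : ℤ} (hσ : σ = 1 ∨ σ = -1) {t : ℝ} (ht : 39 / 50 * a ≤ |t| ∧ |t| ≤ 17 / 20 * a) {q : E3}
    (hq : q ∈ S) (hH : ∀ c ∈ hexCodes, A (lat a c) ∈ nbr S q)
    (hD : ∀ c ∈ upCodes (-σ), A (lat a c + (-t) • e3) ∈ nbr S q)
    (hcs : ∀ θ ∈ nbr S q, -θ ∈ nbr S q) : nbr S q = A '' shellSet a σ t (-σ) (-t) := by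
  have ha0 : a ≠ 0 := by linarith [ha.1]
  have ht0 : t ≠ 0 := by
    intro h; rw [h, abs_zero] at ht; linarith [ha.1, ht.1]
  have hσ' : -σ = 1 ∨ -σ = -1 := by omega
  have hsub : (A : E3 → E3) '' shellSet a σ t (-σ) (-t) ⊆ nbr S q := by
    rintro _ ⟨v, hv, rfl⟩
    obtain ⟨c, t', rfl, ⟨hc, ht'⟩ | ⟨hc, ht'⟩ | ⟨hc, ht'⟩⟩ := exists_of_mem_shellSet hv
    · rw [ht', zero_smul, add_zero]; exact hH c hc
    · have h1 := hcs _ (hD (-c) (neg_mem_upCodes hσ hc))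
      rw [← map_neg, coded_neg, neg_neg, neg_neg] at h1
      rw [ht']; exact h1
    · rw [ht']; exact hD c hc
  obtain ⟨hfin, h12⟩ := nbr_finite_ncard (hS q hq)
  exact Set.eq_of_subset_of_ncard_le hsub (by rw [h12, Set.ncard_image_of_injective _ A.injective,
    ncard_shellSet ha0 hσ hσ' ht0 (neg_ne_zero.2 ht0) (fun h => ht0 (by linarith))]) hfin |>.symm

/-- Two isometric images of the hexagon, one inside the other, coincide. [folklore] -/
theorem image_hex_eq_of_subset (A A' : E3 ≃ₗᵢ[ℝ] E3)
    (h : ∀ c ∈ hexCodes, A'.symm (A (lat a c)) ∈ shellPart a hexCodes 0) :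
    ∀ c ∈ hexCodes, A.symm (A' (lat a c)) ∈ shellPart a hexCodes 0 := by
  have hsub : (A : E3 → E3) '' shellPart a hexCodes 0 ⊆ A' '' shellPart a hexCodes 0 := by
    rintro _ ⟨v, ⟨c, hc, rfl⟩, rfl⟩
    refine ⟨_, h c hc, ?_⟩
    simp
  have heq : (A : E3 → E3) '' shellPart a hexCodes 0 = A' '' shellPart a hexCodes 0 :=
    Set.eq_of_subset_of_ncard_le hsub (by rw [Set.ncard_image_of_injective _ A.injective,
      Set.ncard_image_of_injective _ A'.injective]) ((shellPart_finite _ _ _).image _)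
  intro c hc
  have h1 : A' (lat a c) ∈ (A : E3 → E3) '' shellPart a hexCodes 0 := by
    rw [heq]; exact ⟨_, ⟨c, hc, by simp⟩, rfl⟩
  obtain ⟨v, hv, hve⟩ := h1
  rw [← hve, A.symm_apply_apply]
  exact hv

/-- **A new-layer site, general case**: if the shell of `q ∈ S` contains the hexagon of the
frame `A` and the hole triple of type `−σ` at height `−t`, then it is `A '' shellSet a σ' t' σ₂' t₂'`
for admissible `σ', t'` with `t'` of the sign of `t` (the continuing side). [folklore] -/
theorem newsite_params (hS : ∀ y ∈ S, ExactLayeredAt S y) {A : E3 ≃ₗᵢ[ℝ] E3}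
    (ha : 47 / 50 ≤ a ∧ a ≤ 1) {σ : ℤ} (hσ : σ = 1 ∨ σ = -1) {t : ℝ}
    (ht : 39 / 50 * a ≤ |t| ∧ |t| ≤ 17 / 20 * a) {q : E3} (hq : q ∈ S)
    (hH : ∀ c ∈ hexCodes, A (lat a c) ∈ nbr S q)
    (hD : ∀ c ∈ upCodes (-σ), A (lat a c + (-t) • e3) ∈ nbr S q) :
    ∃ (σ' : ℤ) (t' : ℝ) (σ₂' : ℤ) (t₂' : ℝ), (σ' = 1 ∨ σ' = -1) ∧
      (39 / 50 * a ≤ |t'| ∧ |t'| ≤ 17 / 20 * a) ∧ 0 < t * t' ∧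
      nbr S q = A '' shellSet a σ' t' σ₂' t₂' := by
  have ha0 : a ≠ 0 := by linarith [ha.1]
  have ht0 : t ≠ 0 := by
    intro h; rw [h, abs_zero] at ht; linarith [ha.1, ht.1]
  by_cases hcs : ∀ θ ∈ nbr S q, -θ ∈ nbr S q
  · exact ⟨σ, t, -σ, -t, hσ, ht, mul_self_pos.2 ht0, newsite_cs hS ha hσ ht hq hH hD hcs⟩
  -- the non-symmetric case: reframe the data at `q`
  obtain ⟨A', a', s', z', hadm', hz0', -, -, hN'⟩ := site (hS q hq)
  obtain ⟨ha1', ha2', hs', hz'⟩ := hadm'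
  have ha0' : a' ≠ 0 := by linarith
  obtain ⟨ht1', ht2', hzp', hzn'⟩ := abs_heights_of_adm ⟨ha1', ha2', hs', hz'⟩ hz0'
  have hσ₁' : s' 0 = 1 ∨ s' 0 = -1 := hs' 0
  have hσ₂' : -s' (-1) = 1 ∨ -s' (-1) = -1 := by rcases hs' (-1) with h | h <;> omega
  set N' := shellSet a' (s' 0) (z' 1) (-s' (-1)) (z' (-1)) with hN'def
  have hmem : ∀ θ ∈ nbr S q, A'.symm θ ∈ N' := by
    intro θ hθ
    rw [hN'] at hθ
    obtain ⟨p, hp, rfl⟩ := hθ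
    rw [A'.symm_apply_apply]
    exact hp
  -- every hexagon vector is in-plane for the data at `q`
  have hhex : ∀ c ∈ hexCodes, A'.symm (A (lat a c)) ∈ shellPart a' hexCodes 0 := by
    intro c hc
    by_contra hnot
    apply hcs
    obtain ⟨hr1, hr2, -⟩ := rot_mem_hexCodes hc
    have hap : 0 < a := by linarith [ha.1]
    have k1 : A'.symm (A (lat a c)) ∈ N' := hmem _ (hH c hc)
    have k2 : -A'.symm (A (lat a c)) ∈ N' := by
      rw [← map_neg, ← map_neg, ← lat_neg]; exact hmem _ (hH _ (neg_mem_hexCodes hc))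
    have k3 : A'.symm (A (lat a (rot c))) ∈ N' := hmem _ (hH _ hr1)
    have k4 : A'.symm (A (lat a c)) - A'.symm (A (lat a (rot c))) ∈ N' := by
      rw [← map_sub, ← map_sub, ← lat_sub]; exact hmem _ (hH _ hr2)
    have hn1 : ‖A'.symm (A (lat a (rot c)))‖ = ‖A'.symm (A (lat a c))‖ := by
      rw [A'.symm.norm_map, A'.symm.norm_map, norm_map_lat_hex A hap hr1, norm_map_lat_hex A hap hc]
    have hn2 : ‖A'.symm (A (lat a c)) - A'.symm (A (lat a (rot c)))‖ = ‖A'.symm (A (lat a c))‖ := by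
      rw [← map_sub, ← map_sub, ← lat_sub, A'.symm.norm_map, norm_map_lat_hex A hap hr2,
        A'.symm.norm_map, norm_map_lat_hex A hap hc]
    obtain ⟨hcs1, hcs2, -⟩ :=
      csi_of_not_hex ha0' hσ₁' hσ₂' hzp'.ne' hzn'.ne k1 k2 k3 k4 hn1 hn2 hnot
    intro θ hθ
    have h1 : -A'.symm θ ∈ N' := by
      have := hmem θ hθ
      rw [hN'def, hcs1, hcs2] at this ⊢
      exact neg_mem_shellSet_cs ha0' hσ₁' this
    rw [hN']
    exact ⟨_, h1, by simp⟩
  -- hence `a' = a`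
  obtain rfl : a' = a := by
    obtain ⟨c₁, hc₁, e₁⟩ := exists_of_mem_shellPart (hhex _ mem_hexCodes_basic.1)
    rw [zero_smul, add_zero] at e₁
    have h1 : ‖A'.symm (A (lat a (3, 0)))‖ = a := by
      rw [A'.symm.norm_map]; exact norm_map_lat_hex A (by linarith [ha.1]) mem_hexCodes_basic.1
    rw [e₁] at h1
    have h2 : ‖lat a' c₁‖ = a' := norm_lat_hex (by linarith) hc₁
    linarith
  -- reframe `G = A⁻¹ ∘ A'`
  set G : E3 ≃ₗᵢ[ℝ] E3 := A'.trans A.symm with hG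
  have hGhex : ∀ c ∈ hexCodes, G (lat a' c) ∈ shellPart a' hexCodes 0 :=
    image_hex_eq_of_subset A A' hhex
  obtain ⟨d, hd, ε, hε, hGe⟩ := reframe ha0 G hGhex
  have himage : nbr S q = A '' shellSet a' (typeSign d * s' 0) (ε * z' 1) (typeSign d * -s' (-1))
      (ε * z' (-1)) := by
    rw [← image_shellSet_of_reframe hd hGe hσ₁' hσ₂', hN', Set.image_image]
    congr 1
    ext x
    simp [hG]
  have hτ := typeSign_cases d
  have hτ₁ : typeSign d * s' 0 = 1 ∨ typeSign d * s' 0 = -1 := by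
    rcases hτ with h | h <;> rcases hσ₁' with h' | h' <;> simp [h, h']
  have hτ₂ : typeSign d * -s' (-1) = 1 ∨ typeSign d * -s' (-1) = -1 := by
    rcases hτ with h | h <;> rcases hσ₂' with h' | h' <;> rw [h, h'] <;> norm_num
  have hb1 : 39 / 50 * a' ≤ |ε * z' 1| ∧ |ε * z' 1| ≤ 17 / 20 * a' := by
    rcases hε with h | h <;> simp [h, ht1']
  have hb2 : 39 / 50 * a' ≤ |ε * z' (-1)| ∧ |ε * z' (-1)| ≤ 17 / 20 * a' := by
    rcases hε with h | h <;> simp [h, ht2']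
  -- order the two triples so that the first continues in the direction of `t`
  rcases lt_or_gt_of_ne (show t * (ε * z' 1) ≠ 0 from mul_ne_zero ht0
    (mul_ne_zero (by rcases hε with h | h <;> simp [h]) hzp'.ne')) with hneg | hpos
  · refine ⟨_, _, _, _, hτ₂, hb2, ?_, by rw [himage, shellSet_comm]⟩
    have : (t * (ε * z' 1)) * (t * (ε * z' (-1))) < 0 := by
      have e : (t * (ε * z' 1)) * (t * (ε * z' (-1))) = t ^ 2 * ε ^ 2 * (z' 1 * z' (-1)) := by ring
      rw [e]
      have h1 : 0 < t ^ 2 := by positivity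
      have h2 : 0 < ε ^ 2 := by rcases hε with h | h <;> simp [h]
      have h3 : z' 1 * z' (-1) < 0 := mul_neg_of_pos_of_neg hzp' hzn'
      exact mul_neg_of_pos_of_neg (mul_pos h1 h2) h3
    nlinarith
  · exact ⟨_, _, _, _, hτ₁, hb1, hpos, himage⟩

/-- Decidable bookkeeping: a hole code of type `−σ` plus `(σ, σ)` is a lattice code. [folklore] -/
theorem diag_add_upCodes_neg {σ : ℤ} (hσ : σ = 1 ∨ σ = -1) {c : ℤ × ℤ} (hc : c ∈ upCodes (-σ)) :
    ∃ i j : ℤ, (σ, σ) + c = (3 * i, 3 * j) := by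
  have key : ∀ σ ∈ signs, ∀ c ∈ upCodes (-σ), 3 ∣ ((σ, σ) + c).1 ∧ 3 ∣ ((σ, σ) + c).2 := by decide
  obtain ⟨⟨i, hi⟩, ⟨j, hj⟩⟩ := key σ (mem_signs.2 hσ) c hc
  exact ⟨i, j, Prod.ext hi hj⟩

/-- **One layer forces the next** (Hales, DSP §1.3, "a single hexagonal layer forces an
infinite sequence of close-packed hexagonal layers", here with the distorted patterns of the
admissible layered family): if the full layer `c + A(ℤu + ℤv)` lies in `S` with a constant first
shell whose triple on one side is of type `σ` at height `t`, then the full layer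
`c + A(σ w + t e₃) + A(ℤu + ℤv)` lies in `S` with a constant first shell, whose continuing triple
is again of an admissible type and height. [cite: HalesDSP2012, §1.3] -/
theorem layer_step (hS : ∀ y ∈ S, ExactLayeredAt S y) {A : E3 ≃ₗᵢ[ℝ] E3} (ha : 47 / 50 ≤ a ∧ a ≤ 1)
    {c : E3} {σ : ℤ} (hσ : σ = 1 ∨ σ = -1) {t : ℝ} (ht : 39 / 50 * a ≤ |t| ∧ |t| ≤ 17 / 20 * a)
    {σ₂ : ℤ} {t₂ : ℝ}
    (hlay : ∀ i j : ℤ, c + A (lat a (3 * i, 3 * j)) ∈ S ∧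
      nbr S (c + A (lat a (3 * i, 3 * j))) = A '' shellSet a σ t σ₂ t₂) :
    ∃ (σ' : ℤ) (t' : ℝ) (σ₂' : ℤ) (t₂' : ℝ), (σ' = 1 ∨ σ' = -1) ∧
      (39 / 50 * a ≤ |t'| ∧ |t'| ≤ 17 / 20 * a) ∧ 0 < t * t' ∧
      ∀ i j : ℤ, (c + A (lat a (σ, σ) + t • e3)) + A (lat a (3 * i, 3 * j)) ∈ S ∧
        nbr S ((c + A (lat a (σ, σ) + t • e3)) + A (lat a (3 * i, 3 * j))) =
          A '' shellSet a σ' t' σ₂' t₂' := by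
  have ha0 : a ≠ 0 := by linarith [ha.1]
  have hap : 0 < a := by linarith [ha.1]
  have ht0 : t ≠ 0 := by
    intro h; rw [h, abs_zero] at ht; linarith [ha.1, ht.1]
  set c' := c + A (lat a (σ, σ) + t • e3) with hc'
  -- shell vectors at the old sites
  have hup : ∀ (i j : ℤ), ∀ cu ∈ upCodes σ,
      c + A (lat a (3 * i, 3 * j)) + A (lat a cu + t • e3) ∈ S := by
    intro i j cu hcu
    have h1 : A (lat a cu + t • e3) ∈ nbr S (c + A (lat a (3 * i, 3 * j))) := by
      rw [(hlay i j).2]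
      exact ⟨_, (coded_mem_shellSet_iff ha0).2 (Or.inr (Or.inl ⟨hcu, rfl⟩)), rfl⟩
    exact h1.1
  have hsite : ∀ i j : ℤ, c' + A (lat a (3 * i, 3 * j)) =
      c + A (lat a (3 * i, 3 * j)) + A (lat a (σ, σ) + t • e3) := by
    intro i j; rw [hc']; abel
  -- (F1) the new layer is in `S`
  have hF1 : ∀ i j : ℤ, c' + A (lat a (3 * i, 3 * j)) ∈ S := by
    intro i j; rw [hsite]; exact hup i j _ (diag_mem_upCodes σ)
  -- (F2) the hexagon at the new sites
  have hF2 : ∀ (i j : ℤ), ∀ ch ∈ hexCodes, A (lat a ch) ∈ nbr S (c' + A (lat a (3 * i, 3 * j))) := by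
    intro i j ch hch
    refine ⟨?_, norm_map_lat_hex_bounds A ha hch⟩
    obtain ⟨i', j', rfl⟩ := exists_eq_of_mem_hexCodes hch
    have := hF1 (i + i') (j + j')
    rwa [show ((3 * (i + i'), 3 * (j + j')) : ℤ × ℤ) = (3 * i, 3 * j) + (3 * i', 3 * j') by
      ext <;> simp <;> ring, lat_add, map_add, ← add_assoc] at this
  -- (F3) the old layer seen from the new sites
  have hF3 : ∀ (i j : ℤ), ∀ cd ∈ upCodes (-σ),
      A (lat a cd + (-t) • e3) ∈ nbr S (c' + A (lat a (3 * i, 3 * j))) := by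
    intro i j cd hcd
    have hσ' : -σ = 1 ∨ -σ = -1 := by omega
    refine ⟨?_, norm_map_coded_up_bounds A ha hσ' (by rwa [abs_neg]) hcd⟩
    obtain ⟨i', j', he⟩ := diag_add_upCodes_neg hσ hcd
    have h1 := (hlay (i + i') (j + j')).1
    have e : lat a (σ, σ) + t • e3 + lat a (3 * i, 3 * j) + (lat a cd + (-t) • e3) =
        lat a (3 * (i + i'), 3 * (j + j')) := by
      rw [lat_eq_coded a (3 * i, 3 * j), coded_add, coded_add,
        show t + 0 + -t = 0 by ring, zero_smul, add_zero]
      congr 1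
      rw [add_right_comm, he]
      ext <;> simp <;> ring
    have e2 : A (lat a (σ, σ) + t • e3) + A (lat a (3 * i, 3 * j)) + A (lat a cd + (-t) • e3) =
        A (lat a (3 * (i + i'), 3 * (j + j'))) := by
      rw [← map_add, ← map_add, e]
    have e3' : c' + A (lat a (3 * i, 3 * j)) + A (lat a cd + (-t) • e3) =
        c + (A (lat a (σ, σ) + t • e3) + A (lat a (3 * i, 3 * j)) + A (lat a cd + (-t) • e3)) := by
      rw [hc']; abel
    rw [e3', e2]
    exact h1
  -- the parameters at the base site
  obtain ⟨σ', t', σ₂', t₂', hσ'1, ht', htt', hbase⟩ :=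
    newsite_params hS ha hσ ht (by simpa using hF1 0 0) (by simpa using hF2 0 0)
      (by simpa using hF3 0 0)
  refine ⟨σ', t', σ₂', t₂', hσ'1, ht', htt', fun i j => ⟨hF1 i j, ?_⟩⟩
  -- constancy along the new layer
  by_cases hcs : ∀ θ ∈ nbr S c', -θ ∈ nbr S c'
  · have hbase' := newsite_cs hS ha hσ ht (by simpa using hF1 0 0) (by simpa using hF2 0 0)
      (by simpa using hF3 0 0) hcs
    by_cases hcs' : ∀ θ ∈ nbr S (c' + A (lat a (3 * i, 3 * j))), -θ ∈ nbr S (c' + A (lat a (3 * i, 3 * j)))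
    · rw [newsite_cs hS ha hσ ht (hF1 i j) (hF2 i j) (hF3 i j) hcs', ← hbase', hbase]
    · exfalso
      apply hcs'
      have hconst := layer_const hS (hF1 i j) (fun h => hcs' h.1) hap (hF2 i j) (-i) (-j)
      rw [add_assoc, ← map_add, ← lat_add, show ((3 * i, 3 * j) : ℤ × ℤ) + (3 * -i, 3 * -j) = 0 by
        ext <;> simp] at hconst
      simp only [lat_zero, map_zero, add_zero] at hconst
      rw [← hconst.2]
      exact hcs
  · have hconst := layer_const hS (by simpa using hF1 0 0) (fun h => hcs h.1) hap
      (by simpa using hF2 0 0) i j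
    rw [hconst.2, hbase]

end Step

/-- **Main statement of this file** (registered sub-goal `globalize_layer_step`). [folklore] -/
theorem globalize_layer_step : ∀ (S : Set E3), (∀ y ∈ S, ExactLayeredAt S y) → ∀ (A : E3 ≃ₗᵢ[ℝ] E3) (a : ℝ), (47 / 50 ≤ a ∧ a ≤ 1) → ∀ (c : E3) (σ : ℤ), (σ = 1 ∨ σ = -1) → ∀ (t : ℝ), (39 / 50 * a ≤ |t| ∧ |t| ≤ 17 / 20 * a) → ∀ (σ₂ : ℤ) (t₂ : ℝ), (∀ i j : ℤ, c + A (lat a (3 * i, 3 * j)) ∈ S ∧ nbr S (c + A (lat a (3 * i, 3 * j))) = A '' shellSet a σ t σ₂ t₂) → ∃ (σ' : ℤ) (t' : ℝ) (σ₂' : ℤ) (t₂' : ℝ), (σ' = 1 ∨ σ' = -1) ∧ (39 / 50 * a ≤ |t'| ∧ |t'| ≤ 17 / 20 * a) ∧ 0 < t * t' ∧ ∀ i j : ℤ, (c + A (lat a (σ, σ) + t • e3)) + A (lat a (3 * i, 3 * j)) ∈ S ∧ nbr S ((c + A (lat a (σ, σ) + t • e3)) + A (lat a (3 * i, 3 *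 j))) = A '' shellSet a σ' t' σ₂' t₂' :=
  fun _ hS _ _ ha _ _ hσ _ ht _ _ hlay => layer_step hS ha hσ ht hlay

end Summit.AtomisticToContinuum.Crystallization.Theorems.SlackRigidityPricedFloorsGlobalize

end
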